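import Summits.Parity.GeneralizedHardyLittlewood.Theorems.PrimeLevelFamEdgeMomentsBeyondDiagonalDiagDecorOrderTwoFourSplit
import Summits.Parity.GeneralizedHardyLittlewood.Theorems.PrimeLevelFamEdgeMomentsBeyondDiagonalDiagDecorOrderTwoFourCombine
import Summits.Parity.GeneralizedHardyLittlewood.Theorems.PrimeLevelFamEdgeMomentsBeyondDiagonalDiagDecorOrderTwoTwoPoly
import Summits.Parity.GeneralizedHardyLittlewood.Theorems.PrimeLevelFamEdgeMomentsBeyondDiagonalDiagDecorM4Family
import Summits.Parity.GeneralizedHardyLittlewood.Theorems.PrimeLevelFamEdgeMomentsBeyondDiagonalDiagDecorM6Family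
import HarnessLib

/-!
# Route `PrimeLevelFamEdge`, crux K_A `MomentsBeyondDiagonal` (stmt-Parity-20007), line «petersson_layers» v4, stub `stub_diag`:
# **(Poly₂₄) REDUCED TO ONE NEW ENGINE: the polynomial part of the order-`(2,4)` target from thirty-six landed engine
# instances plus the two-sided `M₄ ⊗ P₂` crude block**

The forty monomials of `…DiagDecorOrderTwoFourSplit.selbergOrderTwoFour_split`: thirty-six are covered by landed engines
(`…ShiftedLpow` `m ≤ 7`, `…ShiftedP2Lpow(')` `m ≤ 5`, `…ShiftedP2P2Lpow` `m ≤ 3`, `…DiagDecorM4Family.abs_selbergM4Lpow_le(')`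
`m ≤ 3`, `…DiagDecorM6Family.abs_selbergM6Lpow_le(')` `m ≤ 1`); the four two-sided `M₄(k₁)·τP₂(k₂)·L^m` (+ mirror, `m ≤ 1`)
are hypotheses `|Sel(·)| ≤ C·log^{m+2}M` (trivial bound minus ONE log = the `M₄` cancellation on one variable): the ONE engine
of rung 3 still to be built (`M₄`-coordinate bound of `…DiagDecorM4Coord` × `P₂`-coordinate bound, family sum as in `…DiagDecorM4Family`).
* `abs_selbergOrderTwoFourPoly_sub_le_of_M4P2` — **`|Sel(poly₂₄)(M) − (π²/6)²(Φ₇/896 − Ψ₅/320 − Ξ₃/64)(λ,P)·log⁴M| ≤ C·log³M`**;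
* `orderTwoFourPoly_of_M4P2` — the same in the hypothesis shape (Poly₂₄) of `…DiagDecorOrderTwoFourAssembly`.

Def-free; theorems only. Helper `--supports stmt-Parity-20007`; closes nothing; K_A, K_B and the Parity summit are NOT proved;
nothing about Landau–Siegel zeros.

## References
* E. Kowalski, P. Michel, J. VanderKam, J. reine angew. Math. 526 (2000), (23)–(28) pp. 13–15 and Prop. 5.1 p. 18.
  [cite: KowalskiMichelVanderKam2000, (23)–(28) — derivation (order-(2,4) piece of the diagonal main term, general Q)]
-/

noncomputable section

open scoped Real ArithmeticFunction.Moebius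
open Literature.NumberTheory.LFunctions Literature.NumberTheory.LFunctions.KMV2000
open Literature.NumberTheory.Sieve (one_le_log_of_three_le)
open Finset ArithmeticFunction Polynomial MeasureTheory Set

namespace Summit.Parity.GeneralizedHardyLittlewood.Theorems.MomentsBeyondDiagonal.DiagKernel

open Literature.NumberTheory.LFunctions Literature.NumberTheory.LFunctions.KMV2000

set_option maxHeartbeats 4000000 in
set_option maxRecDepth 8192 in
-- large statement, forty engine instances
/-- **(Poly₂₄) FROM THE TWO-SIDED `M₄ ⊗ P₂` BLOCK BOUNDS**: for `0 ≤ λ ≤ 1`, `P₀ = P₁ = 0`, arbitrary reals `E_ab, μ₂, μ₄, μ₆`, and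
bounds `|Sel(M₄(k₁)·τP₂(k₂)·L^m)| ≤ C log^{m+2}M`, `|Sel(τP₂(k₁)·M₄(k₂)·L^m)| ≤ C log^{m+2}M` (`m ≤ 1`, `M ≥ 3`), there is `C` with
`|Sel(poly₂₄)(M) − (π²/6)²(Φ₇/896 − Ψ₅/320 − Ξ₃/64)(λ,P)·log⁴M| ≤ C·log³M` for all `M ≥ 3` (the other thirty-six monomials
by the landed engines). [cite: KowalskiMichelVanderKam2000, (23)–(28) and Prop. 5.1 — derivation (order-(2,4) piece of the diagonal main term)] -/
theorem abs_selbergOrderTwoFourPoly_sub_le_of_M4P2 (P : ℝ[X]) (hP0 : P.coeff 0 = 0) (hP1 : P.coeff 1 = 0)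
    {lam : ℝ} (hlam0 : 0 ≤ lam) (hlam1 : lam ≤ 1) (E₀₀ E₀₁ E₀₂ E₀₃ E₀₄ E₁₀ E₁₁ E₁₂ E₁₃ E₁₄ E₂₀ E₂₁ E₂₂ E₂₃ E₂₄ μ₂ μ₄ μ₆ : ℝ)
    (hRa : ∀ m : ℕ, m ≤ 1 → ∃ C : ℝ, ∀ M : ℝ, 3 ≤ M →
      |∑ c ∈ Icc 1 ⌊M⌋₊, ∑ g ∈ Icc 1 (⌊M⌋₊ / c), (μ g : ℝ) * c *
        ∑ k₁ ∈ Icc 1 (⌊M⌋₊ / (c * g)), ∑ k₂ ∈ Icc 1 (⌊M⌋₊ / (c * g)),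
          ((μ (c * g * k₁) : ℝ) * ((psi (c * g * k₁))⁻¹ *
              P.eval (Real.log (M / ((c * g * k₁ : ℕ) : ℝ)) / Real.log M)) / ((c * g * k₁ : ℕ) : ℝ)) *
            ((μ (c * g * k₂) : ℝ) * ((psi (c * g * k₂))⁻¹ *
              P.eval (Real.log (M / ((c * g * k₂ : ℕ) : ℝ)) / Real.log M)) / ((c * g * k₂ : ℕ) : ℝ)) *
            ((k₁.divisors.card : ℝ) * (3 * (∑ p ∈ k₁.primeFactors, Real.log p ^ 2) ^ 2 - 2 * ∑ p ∈ k₁.primeFactors, Real.log p ^ 4) *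
                ((k₂.divisors.card : ℝ) * (∑ p ∈ k₂.primeFactors, Real.log p ^ 2)) *
                (2 * (lam * Real.log M) - 2 * Real.log g - Real.log k₁ - Real.log k₂) ^ m)| ≤ C * Real.log M ^ (m + 2))
    (hRb : ∀ m : ℕ, m ≤ 1 → ∃ C : ℝ, ∀ M : ℝ, 3 ≤ M →
      |∑ c ∈ Icc 1 ⌊M⌋₊, ∑ g ∈ Icc 1 (⌊M⌋₊ / c), (μ g : ℝ) * c *
        ∑ k₁ ∈ Icc 1 (⌊M⌋₊ / (c * g)), ∑ k₂ ∈ Icc 1 (⌊M⌋₊ / (c * g)),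
          ((μ (c * g * k₁) : ℝ) * ((psi (c * g * k₁))⁻¹ *
              P.eval (Real.log (M / ((c * g * k₁ : ℕ) : ℝ)) / Real.log M)) / ((c * g * k₁ : ℕ) : ℝ)) *
            ((μ (c * g * k₂) : ℝ) * ((psi (c * g * k₂))⁻¹ *
              P.eval (Real.log (M / ((c * g * k₂ : ℕ) : ℝ)) / Real.log M)) / ((c * g * k₂ : ℕ) : ℝ)) *
            ((k₁.divisors.card : ℝ) * (∑ p ∈ k₁.primeFactors, Real.log p ^ 2) *
                ((k₂.divisors.card : ℝ) * (3 * (∑ p ∈ k₂.primeFactors, Real.log p ^ 2) ^ 2 - 2 * ∑ p ∈ k₂.primeFactors, Real.log p ^ 4)) *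
                (2 * (lam * Real.log M) - 2 * Real.log g - Real.log k₁ - Real.log k₂) ^ m)| ≤ C * Real.log M ^ (m + 2)) :
    ∃ C : ℝ, ∀ M : ℝ, 3 ≤ M →
      |∑ c ∈ Icc 1 ⌊M⌋₊, ∑ g ∈ Icc 1 (⌊M⌋₊ / c), (μ g : ℝ) * c *
        ∑ k₁ ∈ Icc 1 (⌊M⌋₊ / (c * g)), ∑ k₂ ∈ Icc 1 (⌊M⌋₊ / (c * g)),
          ((μ (c * g * k₁) : ℝ) * ((psi (c * g * k₁))⁻¹ *
              P.eval (Real.log (M / ((c * g * k₁ : ℕ) : ℝ)) / Real.log M)) / ((c * g * k₁ : ℕ) : ℝ)) *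
            ((μ (c * g * k₂) : ℝ) * ((psi (c * g * k₂))⁻¹ *
              P.eval (Real.log (M / ((c * g * k₂ : ℕ) : ℝ)) / Real.log M)) / ((c * g * k₂ : ℕ) : ℝ)) *
            ((1 / 896) * ((k₁.divisors.card : ℝ) * (k₂.divisors.card : ℝ) *
                (2 * (lam * Real.log M) - 2 * Real.log g - Real.log k₁ - Real.log k₂) ^ 7) +
              (E₀₀ / 64) * ((k₁.divisors.card : ℝ) * (k₂.divisors.card : ℝ) *
                (2 * (lam * Real.log M) - 2 * Real.log g - Real.log k₁ - Real.log k₂) ^ 6) +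
              (E₀₁ / 8 + E₁₀ / 16 - μ₂ / 40) * ((k₁.divisors.card : ℝ) * (k₂.divisors.card : ℝ) *
                (2 * (lam * Real.log M) - 2 * Real.log g - Real.log k₁ - Real.log k₂) ^ 5) +
              (3 * E₀₂ / 8 + E₁₁ / 2 + E₂₀ / 16) * ((k₁.divisors.card : ℝ) * (k₂.divisors.card : ℝ) *
                (2 * (lam * Real.log M) - 2 * Real.log g - Real.log k₁ - Real.log k₂) ^ 4) +
              (E₀₃ / 2 + 3 * E₁₂ / 2 + E₂₁ / 2 - μ₄ / 6) * ((k₁.divisors.card : ℝ) * (k₂.divisors.card : ℝ) *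
                (2 * (lam * Real.log M) - 2 * Real.log g - Real.log k₁ - Real.log k₂) ^ 3) +
              (E₀₄ / 4 + 2 * E₁₃ + 3 * E₂₂ / 2) * ((k₁.divisors.card : ℝ) * (k₂.divisors.card : ℝ) *
                (2 * (lam * Real.log M) - 2 * Real.log g - Real.log k₁ - Real.log k₂) ^ 2) +
              (E₁₄ + 2 * E₂₃ + 2 * μ₆) * ((k₁.divisors.card : ℝ) * (k₂.divisors.card : ℝ) *
                (2 * (lam * Real.log M) - 2 * Real.log g - Real.log k₁ - Real.log k₂) ^ 1) +
              E₂₄ * ((k₁.divisors.card : ℝ) * (k₂.divisors.card : ℝ) *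
                (2 * (lam * Real.log M) - 2 * Real.log g - Real.log k₁ - Real.log k₂) ^ 0) +
              (-1 / 640) * ((k₁.divisors.card : ℝ) * (∑ p ∈ k₁.primeFactors, Real.log p ^ 2) * (k₂.divisors.card : ℝ) *
                (2 * (lam * Real.log M) - 2 * Real.log g - Real.log k₁ - Real.log k₂) ^ 5) +
              (-E₀₀ / 64) * ((k₁.divisors.card : ℝ) * (∑ p ∈ k₁.primeFactors, Real.log p ^ 2) * (k₂.divisors.card : ℝ) *
                (2 * (lam * Real.log M) - 2 * Real.log g - Real.log k₁ - Real.log k₂) ^ 4) +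
              (-E₀₁ / 4 + E₁₀ / 8 - μ₂ / 4) * ((k₁.divisors.card : ℝ) * (∑ p ∈ k₁.primeFactors, Real.log p ^ 2) * (k₂.divisors.card : ℝ) *
                (2 * (lam * Real.log M) - 2 * Real.log g - Real.log k₁ - Real.log k₂) ^ 3) +
              (-3 * E₀₂ / 4 + 3 * E₂₀ / 8) * ((k₁.divisors.card : ℝ) * (∑ p ∈ k₁.primeFactors, Real.log p ^ 2) * (k₂.divisors.card : ℝ) *
                (2 * (lam * Real.log M) - 2 * Real.log g - Real.log k₁ - Real.log k₂) ^ 2) +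
              (-E₀₃ / 2 - 3 * E₁₂ / 2 + 3 * E₂₁ / 2 + 15 * μ₄ / 2) * ((k₁.divisors.card : ℝ) * (∑ p ∈ k₁.primeFactors, Real.log p ^ 2) * (k₂.divisors.card : ℝ) *
                (2 * (lam * Real.log M) - 2 * Real.log g - Real.log k₁ - Real.log k₂) ^ 1) +
              (E₀₄ / 4 - 2 * E₁₃ + 3 * E₂₂ / 2) * ((k₁.divisors.card : ℝ) * (∑ p ∈ k₁.primeFactors, Real.log p ^ 2) * (k₂.divisors.card : ℝ) *
                (2 * (lam * Real.log M) - 2 * Real.log g - Real.log k₁ - Real.log k₂) ^ 0) +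
              (-1 / 640) * ((k₁.divisors.card : ℝ) * ((k₂.divisors.card : ℝ) * ∑ p ∈ k₂.primeFactors, Real.log p ^ 2) *
                (2 * (lam * Real.log M) - 2 * Real.log g - Real.log k₁ - Real.log k₂) ^ 5) +
              (-E₀₀ / 64) * ((k₁.divisors.card : ℝ) * ((k₂.divisors.card : ℝ) * ∑ p ∈ k₂.primeFactors, Real.log p ^ 2) *
                (2 * (lam * Real.log M) - 2 * Real.log g - Real.log k₁ - Real.log k₂) ^ 4) +
              (-E₀₁ / 4 + E₁₀ / 8 - μ₂ / 4) * ((k₁.divisors.card : ℝ) * ((k₂.divisors.card : ℝ) * ∑ p ∈ k₂.primeFactors, Real.log p ^ 2) *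
                (2 * (lam * Real.log M) - 2 * Real.log g - Real.log k₁ - Real.log k₂) ^ 3) +
              (-3 * E₀₂ / 4 + 3 * E₂₀ / 8) * ((k₁.divisors.card : ℝ) * ((k₂.divisors.card : ℝ) * ∑ p ∈ k₂.primeFactors, Real.log p ^ 2) *
                (2 * (lam * Real.log M) - 2 * Real.log g - Real.log k₁ - Real.log k₂) ^ 2) +
              (-E₀₃ / 2 - 3 * E₁₂ / 2 + 3 * E₂₁ / 2 + 15 * μ₄ / 2) * ((k₁.divisors.card : ℝ) * ((k₂.divisors.card : ℝ) * ∑ p ∈ k₂.primeFactors, Real.log p ^ 2) *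
                (2 * (lam * Real.log M) - 2 * Real.log g - Real.log k₁ - Real.log k₂) ^ 1) +
              (E₀₄ / 4 - 2 * E₁₃ + 3 * E₂₂ / 2) * ((k₁.divisors.card : ℝ) * ((k₂.divisors.card : ℝ) * ∑ p ∈ k₂.primeFactors, Real.log p ^ 2) *
                (2 * (lam * Real.log M) - 2 * Real.log g - Real.log k₁ - Real.log k₂) ^ 0) +
              (-1 / 64) * ((k₁.divisors.card : ℝ) * (∑ p ∈ k₁.primeFactors, Real.log p ^ 2) *
                ((k₂.divisors.card : ℝ) * (∑ p ∈ k₂.primeFactors, Real.log p ^ 2)) *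
                (2 * (lam * Real.log M) - 2 * Real.log g - Real.log k₁ - Real.log k₂) ^ 3) +
              (-3 * E₀₀ / 32) * ((k₁.divisors.card : ℝ) * (∑ p ∈ k₁.primeFactors, Real.log p ^ 2) *
                ((k₂.divisors.card : ℝ) * (∑ p ∈ k₂.primeFactors, Real.log p ^ 2)) *
                (2 * (lam * Real.log M) - 2 * Real.log g - Real.log k₁ - Real.log k₂) ^ 2) +
              (3 * E₀₁ / 4 - 9 * E₁₀ / 8 + 45 * μ₂ / 4) * ((k₁.divisors.card : ℝ) * (∑ p ∈ k₁.primeFactors, Real.log p ^ 2) *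
                ((k₂.divisors.card : ℝ) * (∑ p ∈ k₂.primeFactors, Real.log p ^ 2)) *
                (2 * (lam * Real.log M) - 2 * Real.log g - Real.log k₁ - Real.log k₂) ^ 1) +
              (9 * E₀₂ / 4 - 3 * E₁₁ + 3 * E₂₀ / 8) * ((k₁.divisors.card : ℝ) * (∑ p ∈ k₁.primeFactors, Real.log p ^ 2) *
                ((k₂.divisors.card : ℝ) * (∑ p ∈ k₂.primeFactors, Real.log p ^ 2)) *
                (2 * (lam * Real.log M) - 2 * Real.log g - Real.log k₁ - Real.log k₂) ^ 0) +
              (-1 / 384) * ((k₁.divisors.card : ℝ) * (3 * (∑ p ∈ k₁.primeFactors, Real.log p ^ 2) ^ 2 - 2 * ∑ p ∈ k₁.primeFactors, Real.log p ^ 4) *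
                (k₂.divisors.card : ℝ) * (2 * (lam * Real.log M) - 2 * Real.log g - Real.log k₁ - Real.log k₂) ^ 3) +
              (-E₀₀ / 64) * ((k₁.divisors.card : ℝ) * (3 * (∑ p ∈ k₁.primeFactors, Real.log p ^ 2) ^ 2 - 2 * ∑ p ∈ k₁.primeFactors, Real.log p ^ 4) *
                (k₂.divisors.card : ℝ) * (2 * (lam * Real.log M) - 2 * Real.log g - Real.log k₁ - Real.log k₂) ^ 2) +
              (E₀₁ / 8 - 3 * E₁₀ / 16 + 15 * μ₂ / 8) * ((k₁.divisors.card : ℝ) * (3 * (∑ p ∈ k₁.primeFactors, Real.log p ^ 2) ^ 2 - 2 * ∑ p ∈ k₁.primeFactors, Real.log p ^ 4) *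
                (k₂.divisors.card : ℝ) * (2 * (lam * Real.log M) - 2 * Real.log g - Real.log k₁ - Real.log k₂) ^ 1) +
              (3 * E₀₂ / 8 - E₁₁ / 2 + E₂₀ / 16) * ((k₁.divisors.card : ℝ) * (3 * (∑ p ∈ k₁.primeFactors, Real.log p ^ 2) ^ 2 - 2 * ∑ p ∈ k₁.primeFactors, Real.log p ^ 4) *
                (k₂.divisors.card : ℝ) * (2 * (lam * Real.log M) - 2 * Real.log g - Real.log k₁ - Real.log k₂) ^ 0) +
              (-1 / 384) * ((k₁.divisors.card : ℝ) * ((k₂.divisors.card : ℝ) *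
                (3 * (∑ p ∈ k₂.primeFactors, Real.log p ^ 2) ^ 2 - 2 * ∑ p ∈ k₂.primeFactors, Real.log p ^ 4)) *
                (2 * (lam * Real.log M) - 2 * Real.log g - Real.log k₁ - Real.log k₂) ^ 3) +
              (-E₀₀ / 64) * ((k₁.divisors.card : ℝ) * ((k₂.divisors.card : ℝ) *
                (3 * (∑ p ∈ k₂.primeFactors, Real.log p ^ 2) ^ 2 - 2 * ∑ p ∈ k₂.primeFactors, Real.log p ^ 4)) *
                (2 * (lam * Real.log M) - 2 * Real.log g - Real.log k₁ - Real.log k₂) ^ 2) +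
              (E₀₁ / 8 - 3 * E₁₀ / 16 + 15 * μ₂ / 8) * ((k₁.divisors.card : ℝ) * ((k₂.divisors.card : ℝ) *
                (3 * (∑ p ∈ k₂.primeFactors, Real.log p ^ 2) ^ 2 - 2 * ∑ p ∈ k₂.primeFactors, Real.log p ^ 4)) *
                (2 * (lam * Real.log M) - 2 * Real.log g - Real.log k₁ - Real.log k₂) ^ 1) +
              (3 * E₀₂ / 8 - E₁₁ / 2 + E₂₀ / 16) * ((k₁.divisors.card : ℝ) * ((k₂.divisors.card : ℝ) *
                (3 * (∑ p ∈ k₂.primeFactors, Real.log p ^ 2) ^ 2 - 2 * ∑ p ∈ k₂.primeFactors, Real.log p ^ 4)) *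
                (2 * (lam * Real.log M) - 2 * Real.log g - Real.log k₁ - Real.log k₂) ^ 0) +
              (1 / 128) * ((k₁.divisors.card : ℝ) * (15 * (∑ p ∈ k₁.primeFactors, Real.log p ^ 2) ^ 3 -
                30 * ((∑ p ∈ k₁.primeFactors, Real.log p ^ 2) * ∑ p ∈ k₁.primeFactors, Real.log p ^ 4) +
                16 * ∑ p ∈ k₁.primeFactors, Real.log p ^ 6) *
                (k₂.divisors.card : ℝ) * (2 * (lam * Real.log M) - 2 * Real.log g - Real.log k₁ - Real.log k₂) ^ 1) +
              (E₀₀ / 64) * ((k₁.divisors.card : ℝ) * (15 * (∑ p ∈ k₁.primeFactors, Real.log p ^ 2) ^ 3 -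
                30 * ((∑ p ∈ k₁.primeFactors, Real.log p ^ 2) * ∑ p ∈ k₁.primeFactors, Real.log p ^ 4) +
                16 * ∑ p ∈ k₁.primeFactors, Real.log p ^ 6) *
                (k₂.divisors.card : ℝ) * (2 * (lam * Real.log M) - 2 * Real.log g - Real.log k₁ - Real.log k₂) ^ 0) +
              (1 / 128) * ((k₁.divisors.card : ℝ) * ((k₂.divisors.card : ℝ) *
                (15 * (∑ p ∈ k₂.primeFactors, Real.log p ^ 2) ^ 3 -
                30 * ((∑ p ∈ k₂.primeFactors, Real.log p ^ 2) * ∑ p ∈ k₂.primeFactors, Real.log p ^ 4) +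
                16 * ∑ p ∈ k₂.primeFactors, Real.log p ^ 6)) *
                (2 * (lam * Real.log M) - 2 * Real.log g - Real.log k₁ - Real.log k₂) ^ 1) +
              (E₀₀ / 64) * ((k₁.divisors.card : ℝ) * ((k₂.divisors.card : ℝ) *
                (15 * (∑ p ∈ k₂.primeFactors, Real.log p ^ 2) ^ 3 -
                30 * ((∑ p ∈ k₂.primeFactors, Real.log p ^ 2) * ∑ p ∈ k₂.primeFactors, Real.log p ^ 4) +
                16 * ∑ p ∈ k₂.primeFactors, Real.log p ^ 6)) *
                (2 * (lam * Real.log M) - 2 * Real.log g - Real.log k₁ - Real.log k₂) ^ 0) +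
              (15 / 128) * ((k₁.divisors.card : ℝ) * (3 * (∑ p ∈ k₁.primeFactors, Real.log p ^ 2) ^ 2 - 2 * ∑ p ∈ k₁.primeFactors, Real.log p ^ 4) *
                ((k₂.divisors.card : ℝ) * (∑ p ∈ k₂.primeFactors, Real.log p ^ 2)) *
                (2 * (lam * Real.log M) - 2 * Real.log g - Real.log k₁ - Real.log k₂) ^ 1) +
              (15 * E₀₀ / 64) * ((k₁.divisors.card : ℝ) * (3 * (∑ p ∈ k₁.primeFactors, Real.log p ^ 2) ^ 2 - 2 * ∑ p ∈ k₁.primeFactors, Real.log p ^ 4) *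
                ((k₂.divisors.card : ℝ) * (∑ p ∈ k₂.primeFactors, Real.log p ^ 2)) *
                (2 * (lam * Real.log M) - 2 * Real.log g - Real.log k₁ - Real.log k₂) ^ 0) +
              (15 / 128) * ((k₁.divisors.card : ℝ) * (∑ p ∈ k₁.primeFactors, Real.log p ^ 2) *
                ((k₂.divisors.card : ℝ) * (3 * (∑ p ∈ k₂.primeFactors, Real.log p ^ 2) ^ 2 - 2 * ∑ p ∈ k₂.primeFactors, Real.log p ^ 4)) *
                (2 * (lam * Real.log M) - 2 * Real.log g - Real.log k₁ - Real.log k₂) ^ 1) +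
              (15 * E₀₀ / 64) * ((k₁.divisors.card : ℝ) * (∑ p ∈ k₁.primeFactors, Real.log p ^ 2) *
                ((k₂.divisors.card : ℝ) * (3 * (∑ p ∈ k₂.primeFactors, Real.log p ^ 2) ^ 2 - 2 * ∑ p ∈ k₂.primeFactors, Real.log p ^ 4)) *
                (2 * (lam * Real.log M) - 2 * Real.log g - Real.log k₁ - Real.log k₂) ^ 0)) -
        (π ^ 2 / 6) ^ 2 * ((1 / 896) * (∑ j ∈ Finset.range (7 + 1), ∑ i ∈ Finset.range (j + 1),
            ((7 : ℕ).choose j : ℝ) * (j.choose i : ℝ) * 2 ^ (7 - j) *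
              ∫ u in (0 : ℝ)..1, (((Polynomial.C lam - X) ^ (7 - j) * derivative (derivative (X ^ i * P))) *
                derivative (derivative (X ^ (j - i) * P))).eval u) +
          (-1 / 320) * (∑ j ∈ Finset.range (5 + 1), ∑ i ∈ Finset.range (j + 1),
            ((5 : ℕ).choose j : ℝ) * (j.choose i : ℝ) * 2 ^ (5 - j) *
              ∫ u in (0 : ℝ)..1, (((Polynomial.C lam - X) ^ (5 - j) * (-(2 : ℝ) • (X ^ i * P))) *
                derivative (derivative (X ^ (j - i) * P))).eval u) +
          (-1 / 64) * (∑ j ∈ Finset.range (3 + 1), ∑ i ∈ Finset.range (j + 1),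
            ((3 : ℕ).choose j : ℝ) * (j.choose i : ℝ) * 2 ^ (3 - j) *
              ∫ u in (0 : ℝ)..1, (((Polynomial.C lam - X) ^ (3 - j) * (-(2 : ℝ) • (X ^ i * P))) *
                (-(2 : ℝ) • (X ^ (j - i) * P))).eval u)) * Real.log M ^ 4| ≤ C * Real.log M ^ 3 := by
  obtain ⟨C7, hC7, h7⟩ := abs_selbergLpow_sub_le P hP0 hP1 7 hlam0 hlam1
  obtain ⟨C6, hC6, h6⟩ := abs_selbergLpow_sub_le P hP0 hP1 6 hlam0 hlam1
  obtain ⟨C5, hC5, h5⟩ := abs_selbergLpow_sub_le P hP0 hP1 5 hlam0 hlam1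
  obtain ⟨C4, hC4, h4⟩ := abs_selbergLpow_sub_le P hP0 hP1 4 hlam0 hlam1
  obtain ⟨C3, hC3, h3⟩ := abs_selbergLpow_sub_le P hP0 hP1 3 hlam0 hlam1
  obtain ⟨C2, hC2, h2⟩ := abs_selbergLpow_sub_le P hP0 hP1 2 hlam0 hlam1
  obtain ⟨C1, hC1, h1⟩ := abs_selbergLpow_sub_le P hP0 hP1 1 hlam0 hlam1
  obtain ⟨C0, hC0, h0⟩ := abs_selbergLpow_sub_le P hP0 hP1 0 hlam0 hlam1
  obtain ⟨D5, hD5, g5⟩ := abs_selbergP2Lpow_sub_le P hP0 hP1 5 hlam0 hlam1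
  obtain ⟨D4, hD4, g4⟩ := abs_selbergP2Lpow_sub_le P hP0 hP1 4 hlam0 hlam1
  obtain ⟨D3, hD3, g3⟩ := abs_selbergP2Lpow_sub_le P hP0 hP1 3 hlam0 hlam1
  obtain ⟨D2, hD2, g2⟩ := abs_selbergP2Lpow_sub_le P hP0 hP1 2 hlam0 hlam1
  obtain ⟨D1, hD1, g1⟩ := abs_selbergP2Lpow_sub_le P hP0 hP1 1 hlam0 hlam1
  obtain ⟨D0, hD0, g0⟩ := abs_selbergP2Lpow_sub_le P hP0 hP1 0 hlam0 hlam1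
  obtain ⟨D5', hD5', g5p⟩ := abs_selbergP2Lpow_sub_le' P hP0 hP1 5 hlam0 hlam1
  obtain ⟨D4', hD4', g4p⟩ := abs_selbergP2Lpow_sub_le' P hP0 hP1 4 hlam0 hlam1
  obtain ⟨D3', hD3', g3p⟩ := abs_selbergP2Lpow_sub_le' P hP0 hP1 3 hlam0 hlam1
  obtain ⟨D2', hD2', g2p⟩ := abs_selbergP2Lpow_sub_le' P hP0 hP1 2 hlam0 hlam1
  obtain ⟨D1', hD1', g1p⟩ := abs_selbergP2Lpow_sub_le' P hP0 hP1 1 hlam0 hlam1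
  obtain ⟨D0', hD0', g0p⟩ := abs_selbergP2Lpow_sub_le' P hP0 hP1 0 hlam0 hlam1
  obtain ⟨G3, hG3, u3⟩ := abs_selbergP2P2Lpow_sub_le P hP0 hP1 3 hlam0 hlam1
  obtain ⟨G2, hG2, u2⟩ := abs_selbergP2P2Lpow_sub_le P hP0 hP1 2 hlam0 hlam1
  obtain ⟨G1, hG1, u1⟩ := abs_selbergP2P2Lpow_sub_le P hP0 hP1 1 hlam0 hlam1
  obtain ⟨G0, hG0, u0⟩ := abs_selbergP2P2Lpow_sub_le P hP0 hP1 0 hlam0 hlam1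
  obtain ⟨A3, -, a3⟩ := abs_selbergM4Lpow_le P hP0 hP1 3 hlam0 hlam1
  obtain ⟨A2, -, a2⟩ := abs_selbergM4Lpow_le P hP0 hP1 2 hlam0 hlam1
  obtain ⟨A1, -, a1⟩ := abs_selbergM4Lpow_le P hP0 hP1 1 hlam0 hlam1
  obtain ⟨A0, -, a0⟩ := abs_selbergM4Lpow_le P hP0 hP1 0 hlam0 hlam1
  obtain ⟨B3, -, b3⟩ := abs_selbergM4Lpow_le' P hP0 hP1 3 hlam0 hlam1
  obtain ⟨B2, -, b2⟩ := abs_selbergM4Lpow_le' P hP0 hP1 2 hlam0 hlam1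
  obtain ⟨B1, -, b1⟩ := abs_selbergM4Lpow_le' P hP0 hP1 1 hlam0 hlam1
  obtain ⟨B0, -, b0⟩ := abs_selbergM4Lpow_le' P hP0 hP1 0 hlam0 hlam1
  obtain ⟨CY1, -, y1⟩ := abs_selbergM6Lpow_le P hP0 hP1 1 hlam0 hlam1
  obtain ⟨CY0, -, y0⟩ := abs_selbergM6Lpow_le P hP0 hP1 0 hlam0 hlam1
  obtain ⟨CZ1, -, z1⟩ := abs_selbergM6Lpow_le' P hP0 hP1 1 hlam0 hlam1
  obtain ⟨CZ0, -, z0⟩ := abs_selbergM6Lpow_le' P hP0 hP1 0 hlam0 hlam1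
  obtain ⟨CR1, r1⟩ := hRa 1 (by norm_num)
  obtain ⟨CR0, r0⟩ := hRa 0 (by norm_num)
  obtain ⟨CR1', r1p⟩ := hRb 1 (by norm_num)
  obtain ⟨CR0', r0p⟩ := hRb 0 (by norm_num)
  have hK : 0 ≤ (π ^ 2 / 6 : ℝ) ^ 2 := by positivity
  refine ⟨?_, fun M hM ↦ ?_⟩
  swap
  · have hℓ1 : 1 ≤ Real.log M := one_le_log_of_three_le hM
    simp (config := { maxSteps := 4000000 }) only [selbergProd_add, selbergProd_const_mul]
    exact orderTwoFour_combine (E₀₀ := E₀₀) (E₀₁ := E₀₁) (E₀₂ := E₀₂) (E₀₃ := E₀₃) (E₀₄ := E₀₄) (E₁₀ := E₁₀) (E₁₁ := E₁₁) (E₁₂ := E₁₂) (E₁₃ := E₁₃) (E₁₄ := E₁₄) (E₂₀ := E₂₀) (E₂₁ := E₂₁) (E₂₂ := E₂₂) (E₂₃ := E₂₃) (E₂₄ := E₂₄) (μ₂ := μ₂) (μ₄ := μ₄) (μ₆ := μ₆) hℓ1 hK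
      hC6.le hC5.le hC4.le hC3.le hC2.le hC1.le hC0.le hD4.le hD3.le hD2.le hD1.le hD0.le hD4'.le hD3'.le hD2'.le hD1'.le hD0'.le hG2.le hG1.le hG0.le
      (h7 M hM) (h6 M hM) (h5 M hM) (h4 M hM) (h3 M hM) (h2 M hM) (h1 M hM) (h0 M hM) (g5 M hM) (g4 M hM) (g3 M hM) (g2 M hM) (g1 M hM) (g0 M hM) (g5p M hM) (g4p M hM) (g3p M hM) (g2p M hM) (g1p M hM) (g0p M hM) (u3 M hM) (u2 M hM) (u1 M hM) (u0 M hM) (a3 M hM) (a2 M hM) (a1 M hM) (a0 M hM) (b3 M hM) (b2 M hM) (b1 M hM) (b0 M hM) (y1 M hM) (y0 M hM) (z1 M hM) (z0 M hM) (r1 M hM) (r0 M hM) (r1p M hM) (r0p M hM)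

set_option maxHeartbeats 1600000 in
set_option maxRecDepth 8192 in
-- large statement
/-- **(Poly₂₄) in the exact hypothesis shape of `…DiagDecorOrderTwoFourAssembly.orderTwoFour_target_of_poly_of_remainder`**
(`𝔎(λ,P) = (π²/6)²(Φ₇/896 − Ψ₅/320 − Ξ₃/64)`), from the `M₄ ⊗ P₂` block bounds for every `P`, `λ`.
[cite: KowalskiMichelVanderKam2000, (23)–(28) and Prop. 5.1 — derivation] -/
theorem orderTwoFourPoly_of_M4P2
    (hM4P2 : ∀ P : ℝ[X], P.coeff 0 = 0 → P.coeff 1 = 0 → ∀ lam : ℝ, 0 ≤ lam → lam ≤ 1 → ∀ m : ℕ, m ≤ 1 →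
      (∃ C : ℝ, ∀ M : ℝ, 3 ≤ M →
      |∑ c ∈ Icc 1 ⌊M⌋₊, ∑ g ∈ Icc 1 (⌊M⌋₊ / c), (μ g : ℝ) * c *
        ∑ k₁ ∈ Icc 1 (⌊M⌋₊ / (c * g)), ∑ k₂ ∈ Icc 1 (⌊M⌋₊ / (c * g)),
          ((μ (c * g * k₁) : ℝ) * ((psi (c * g * k₁))⁻¹ *
              P.eval (Real.log (M / ((c * g * k₁ : ℕ) : ℝ)) / Real.log M)) / ((c * g * k₁ : ℕ) : ℝ)) *
            ((μ (c * g * k₂) : ℝ) * ((psi (c * g * k₂))⁻¹ *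
              P.eval (Real.log (M / ((c * g * k₂ : ℕ) : ℝ)) / Real.log M)) / ((c * g * k₂ : ℕ) : ℝ)) *
            ((k₁.divisors.card : ℝ) * (3 * (∑ p ∈ k₁.primeFactors, Real.log p ^ 2) ^ 2 - 2 * ∑ p ∈ k₁.primeFactors, Real.log p ^ 4) *
                ((k₂.divisors.card : ℝ) * (∑ p ∈ k₂.primeFactors, Real.log p ^ 2)) *
                (2 * (lam * Real.log M) - 2 * Real.log g - Real.log k₁ - Real.log k₂) ^ m)| ≤ C * Real.log M ^ (m + 2)) ∧
      (∃ C : ℝ, ∀ M : ℝ, 3 ≤ M →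
      |∑ c ∈ Icc 1 ⌊M⌋₊, ∑ g ∈ Icc 1 (⌊M⌋₊ / c), (μ g : ℝ) * c *
        ∑ k₁ ∈ Icc 1 (⌊M⌋₊ / (c * g)), ∑ k₂ ∈ Icc 1 (⌊M⌋₊ / (c * g)),
          ((μ (c * g * k₁) : ℝ) * ((psi (c * g * k₁))⁻¹ *
              P.eval (Real.log (M / ((c * g * k₁ : ℕ) : ℝ)) / Real.log M)) / ((c * g * k₁ : ℕ) : ℝ)) *
            ((μ (c * g * k₂) : ℝ) * ((psi (c * g * k₂))⁻¹ *
              P.eval (Real.log (M / ((c * g * k₂ : ℕ) : ℝ)) / Real.log M)) / ((c * g * k₂ : ℕ) : ℝ)) *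
            ((k₁.divisors.card : ℝ) * (∑ p ∈ k₁.primeFactors, Real.log p ^ 2) *
                ((k₂.divisors.card : ℝ) * (3 * (∑ p ∈ k₂.primeFactors, Real.log p ^ 2) ^ 2 - 2 * ∑ p ∈ k₂.primeFactors, Real.log p ^ 4)) *
                (2 * (lam * Real.log M) - 2 * Real.log g - Real.log k₁ - Real.log k₂) ^ m)| ≤ C * Real.log M ^ (m + 2))) :
    ∀ P : ℝ[X], P.coeff 0 = 0 → P.coeff 1 = 0 → ∀ lam : ℝ, 0 ≤ lam → lam ≤ 1 →
      ∀ E₀₀ E₀₁ E₀₂ E₀₃ E₀₄ E₁₀ E₁₁ E₁₂ E₁₃ E₁₄ E₂₀ E₂₁ E₂₂ E₂₃ E₂₄ μ₂ μ₄ μ₆ : ℝ, ∃ C : ℝ, ∀ M : ℝ, 3 ≤ M →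
      |∑ c ∈ Icc 1 ⌊M⌋₊, ∑ g ∈ Icc 1 (⌊M⌋₊ / c), (μ g : ℝ) * c *
        ∑ k₁ ∈ Icc 1 (⌊M⌋₊ / (c * g)), ∑ k₂ ∈ Icc 1 (⌊M⌋₊ / (c * g)),
          ((μ (c * g * k₁) : ℝ) * ((psi (c * g * k₁))⁻¹ *
              P.eval (Real.log (M / ((c * g * k₁ : ℕ) : ℝ)) / Real.log M)) / ((c * g * k₁ : ℕ) : ℝ)) *
            ((μ (c * g * k₂) : ℝ) * ((psi (c * g * k₂))⁻¹ *
              P.eval (Real.log (M / ((c * g * k₂ : ℕ) : ℝ)) / Real.log M)) / ((c * g * k₂ : ℕ) : ℝ)) *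
            ((1 / 896) * ((k₁.divisors.card : ℝ) * (k₂.divisors.card : ℝ) *
                (2 * (lam * Real.log M) - 2 * Real.log g - Real.log k₁ - Real.log k₂) ^ 7) +
              (E₀₀ / 64) * ((k₁.divisors.card : ℝ) * (k₂.divisors.card : ℝ) *
                (2 * (lam * Real.log M) - 2 * Real.log g - Real.log k₁ - Real.log k₂) ^ 6) +
              (E₀₁ / 8 + E₁₀ / 16 - μ₂ / 40) * ((k₁.divisors.card : ℝ) * (k₂.divisors.card : ℝ) *
                (2 * (lam * Real.log M) - 2 * Real.log g - Real.log k₁ - Real.log k₂) ^ 5) +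
              (3 * E₀₂ / 8 + E₁₁ / 2 + E₂₀ / 16) * ((k₁.divisors.card : ℝ) * (k₂.divisors.card : ℝ) *
                (2 * (lam * Real.log M) - 2 * Real.log g - Real.log k₁ - Real.log k₂) ^ 4) +
              (E₀₃ / 2 + 3 * E₁₂ / 2 + E₂₁ / 2 - μ₄ / 6) * ((k₁.divisors.card : ℝ) * (k₂.divisors.card : ℝ) *
                (2 * (lam * Real.log M) - 2 * Real.log g - Real.log k₁ - Real.log k₂) ^ 3) +
              (E₀₄ / 4 + 2 * E₁₃ + 3 * E₂₂ / 2) * ((k₁.divisors.card : ℝ) * (k₂.divisors.card : ℝ) *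
                (2 * (lam * Real.log M) - 2 * Real.log g - Real.log k₁ - Real.log k₂) ^ 2) +
              (E₁₄ + 2 * E₂₃ + 2 * μ₆) * ((k₁.divisors.card : ℝ) * (k₂.divisors.card : ℝ) *
                (2 * (lam * Real.log M) - 2 * Real.log g - Real.log k₁ - Real.log k₂) ^ 1) +
              E₂₄ * ((k₁.divisors.card : ℝ) * (k₂.divisors.card : ℝ) *
                (2 * (lam * Real.log M) - 2 * Real.log g - Real.log k₁ - Real.log k₂) ^ 0) +
              (-1 / 640) * ((k₁.divisors.card : ℝ) * (∑ p ∈ k₁.primeFactors, Real.log p ^ 2) * (k₂.divisors.card : ℝ) *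
                (2 * (lam * Real.log M) - 2 * Real.log g - Real.log k₁ - Real.log k₂) ^ 5) +
              (-E₀₀ / 64) * ((k₁.divisors.card : ℝ) * (∑ p ∈ k₁.primeFactors, Real.log p ^ 2) * (k₂.divisors.card : ℝ) *
                (2 * (lam * Real.log M) - 2 * Real.log g - Real.log k₁ - Real.log k₂) ^ 4) +
              (-E₀₁ / 4 + E₁₀ / 8 - μ₂ / 4) * ((k₁.divisors.card : ℝ) * (∑ p ∈ k₁.primeFactors, Real.log p ^ 2) * (k₂.divisors.card : ℝ) *
                (2 * (lam * Real.log M) - 2 * Real.log g - Real.log k₁ - Real.log k₂) ^ 3) +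
              (-3 * E₀₂ / 4 + 3 * E₂₀ / 8) * ((k₁.divisors.card : ℝ) * (∑ p ∈ k₁.primeFactors, Real.log p ^ 2) * (k₂.divisors.card : ℝ) *
                (2 * (lam * Real.log M) - 2 * Real.log g - Real.log k₁ - Real.log k₂) ^ 2) +
              (-E₀₃ / 2 - 3 * E₁₂ / 2 + 3 * E₂₁ / 2 + 15 * μ₄ / 2) * ((k₁.divisors.card : ℝ) * (∑ p ∈ k₁.primeFactors, Real.log p ^ 2) * (k₂.divisors.card : ℝ) *
                (2 * (lam * Real.log M) - 2 * Real.log g - Real.log k₁ - Real.log k₂) ^ 1) +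
              (E₀₄ / 4 - 2 * E₁₃ + 3 * E₂₂ / 2) * ((k₁.divisors.card : ℝ) * (∑ p ∈ k₁.primeFactors, Real.log p ^ 2) * (k₂.divisors.card : ℝ) *
                (2 * (lam * Real.log M) - 2 * Real.log g - Real.log k₁ - Real.log k₂) ^ 0) +
              (-1 / 640) * ((k₁.divisors.card : ℝ) * ((k₂.divisors.card : ℝ) * ∑ p ∈ k₂.primeFactors, Real.log p ^ 2) *
                (2 * (lam * Real.log M) - 2 * Real.log g - Real.log k₁ - Real.log k₂) ^ 5) +
              (-E₀₀ / 64) * ((k₁.divisors.card : ℝ) * ((k₂.divisors.card : ℝ) * ∑ p ∈ k₂.primeFactors, Real.log p ^ 2) *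
                (2 * (lam * Real.log M) - 2 * Real.log g - Real.log k₁ - Real.log k₂) ^ 4) +
              (-E₀₁ / 4 + E₁₀ / 8 - μ₂ / 4) * ((k₁.divisors.card : ℝ) * ((k₂.divisors.card : ℝ) * ∑ p ∈ k₂.primeFactors, Real.log p ^ 2) *
                (2 * (lam * Real.log M) - 2 * Real.log g - Real.log k₁ - Real.log k₂) ^ 3) +
              (-3 * E₀₂ / 4 + 3 * E₂₀ / 8) * ((k₁.divisors.card : ℝ) * ((k₂.divisors.card : ℝ) * ∑ p ∈ k₂.primeFactors, Real.log p ^ 2) *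
                (2 * (lam * Real.log M) - 2 * Real.log g - Real.log k₁ - Real.log k₂) ^ 2) +
              (-E₀₃ / 2 - 3 * E₁₂ / 2 + 3 * E₂₁ / 2 + 15 * μ₄ / 2) * ((k₁.divisors.card : ℝ) * ((k₂.divisors.card : ℝ) * ∑ p ∈ k₂.primeFactors, Real.log p ^ 2) *
                (2 * (lam * Real.log M) - 2 * Real.log g - Real.log k₁ - Real.log k₂) ^ 1) +
              (E₀₄ / 4 - 2 * E₁₃ + 3 * E₂₂ / 2) * ((k₁.divisors.card : ℝ) * ((k₂.divisors.card : ℝ) * ∑ p ∈ k₂.primeFactors, Real.log p ^ 2) *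
                (2 * (lam * Real.log M) - 2 * Real.log g - Real.log k₁ - Real.log k₂) ^ 0) +
              (-1 / 64) * ((k₁.divisors.card : ℝ) * (∑ p ∈ k₁.primeFactors, Real.log p ^ 2) *
                ((k₂.divisors.card : ℝ) * (∑ p ∈ k₂.primeFactors, Real.log p ^ 2)) *
                (2 * (lam * Real.log M) - 2 * Real.log g - Real.log k₁ - Real.log k₂) ^ 3) +
              (-3 * E₀₀ / 32) * ((k₁.divisors.card : ℝ) * (∑ p ∈ k₁.primeFactors, Real.log p ^ 2) *
                ((k₂.divisors.card : ℝ) * (∑ p ∈ k₂.primeFactors, Real.log p ^ 2)) *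
                (2 * (lam * Real.log M) - 2 * Real.log g - Real.log k₁ - Real.log k₂) ^ 2) +
              (3 * E₀₁ / 4 - 9 * E₁₀ / 8 + 45 * μ₂ / 4) * ((k₁.divisors.card : ℝ) * (∑ p ∈ k₁.primeFactors, Real.log p ^ 2) *
                ((k₂.divisors.card : ℝ) * (∑ p ∈ k₂.primeFactors, Real.log p ^ 2)) *
                (2 * (lam * Real.log M) - 2 * Real.log g - Real.log k₁ - Real.log k₂) ^ 1) +
              (9 * E₀₂ / 4 - 3 * E₁₁ + 3 * E₂₀ / 8) * ((k₁.divisors.card : ℝ) * (∑ p ∈ k₁.primeFactors, Real.log p ^ 2) *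
                ((k₂.divisors.card : ℝ) * (∑ p ∈ k₂.primeFactors, Real.log p ^ 2)) *
                (2 * (lam * Real.log M) - 2 * Real.log g - Real.log k₁ - Real.log k₂) ^ 0) +
              (-1 / 384) * ((k₁.divisors.card : ℝ) * (3 * (∑ p ∈ k₁.primeFactors, Real.log p ^ 2) ^ 2 - 2 * ∑ p ∈ k₁.primeFactors, Real.log p ^ 4) *
                (k₂.divisors.card : ℝ) * (2 * (lam * Real.log M) - 2 * Real.log g - Real.log k₁ - Real.log k₂) ^ 3) +
              (-E₀₀ / 64) * ((k₁.divisors.card : ℝ) * (3 * (∑ p ∈ k₁.primeFactors, Real.log p ^ 2) ^ 2 - 2 * ∑ p ∈ k₁.primeFactors, Real.log p ^ 4) *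
                (k₂.divisors.card : ℝ) * (2 * (lam * Real.log M) - 2 * Real.log g - Real.log k₁ - Real.log k₂) ^ 2) +
              (E₀₁ / 8 - 3 * E₁₀ / 16 + 15 * μ₂ / 8) * ((k₁.divisors.card : ℝ) * (3 * (∑ p ∈ k₁.primeFactors, Real.log p ^ 2) ^ 2 - 2 * ∑ p ∈ k₁.primeFactors, Real.log p ^ 4) *
                (k₂.divisors.card : ℝ) * (2 * (lam * Real.log M) - 2 * Real.log g - Real.log k₁ - Real.log k₂) ^ 1) +
              (3 * E₀₂ / 8 - E₁₁ / 2 + E₂₀ / 16) * ((k₁.divisors.card : ℝ) * (3 * (∑ p ∈ k₁.primeFactors, Real.log p ^ 2) ^ 2 - 2 * ∑ p ∈ k₁.primeFactors, Real.log p ^ 4) *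
                (k₂.divisors.card : ℝ) * (2 * (lam * Real.log M) - 2 * Real.log g - Real.log k₁ - Real.log k₂) ^ 0) +
              (-1 / 384) * ((k₁.divisors.card : ℝ) * ((k₂.divisors.card : ℝ) *
                (3 * (∑ p ∈ k₂.primeFactors, Real.log p ^ 2) ^ 2 - 2 * ∑ p ∈ k₂.primeFactors, Real.log p ^ 4)) *
                (2 * (lam * Real.log M) - 2 * Real.log g - Real.log k₁ - Real.log k₂) ^ 3) +
              (-E₀₀ / 64) * ((k₁.divisors.card : ℝ) * ((k₂.divisors.card : ℝ) *
                (3 * (∑ p ∈ k₂.primeFactors, Real.log p ^ 2) ^ 2 - 2 * ∑ p ∈ k₂.primeFactors, Real.log p ^ 4)) *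
                (2 * (lam * Real.log M) - 2 * Real.log g - Real.log k₁ - Real.log k₂) ^ 2) +
              (E₀₁ / 8 - 3 * E₁₀ / 16 + 15 * μ₂ / 8) * ((k₁.divisors.card : ℝ) * ((k₂.divisors.card : ℝ) *
                (3 * (∑ p ∈ k₂.primeFactors, Real.log p ^ 2) ^ 2 - 2 * ∑ p ∈ k₂.primeFactors, Real.log p ^ 4)) *
                (2 * (lam * Real.log M) - 2 * Real.log g - Real.log k₁ - Real.log k₂) ^ 1) +
              (3 * E₀₂ / 8 - E₁₁ / 2 + E₂₀ / 16) * ((k₁.divisors.card : ℝ) * ((k₂.divisors.card : ℝ) *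
                (3 * (∑ p ∈ k₂.primeFactors, Real.log p ^ 2) ^ 2 - 2 * ∑ p ∈ k₂.primeFactors, Real.log p ^ 4)) *
                (2 * (lam * Real.log M) - 2 * Real.log g - Real.log k₁ - Real.log k₂) ^ 0) +
              (1 / 128) * ((k₁.divisors.card : ℝ) * (15 * (∑ p ∈ k₁.primeFactors, Real.log p ^ 2) ^ 3 -
                30 * ((∑ p ∈ k₁.primeFactors, Real.log p ^ 2) * ∑ p ∈ k₁.primeFactors, Real.log p ^ 4) +
                16 * ∑ p ∈ k₁.primeFactors, Real.log p ^ 6) *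
                (k₂.divisors.card : ℝ) * (2 * (lam * Real.log M) - 2 * Real.log g - Real.log k₁ - Real.log k₂) ^ 1) +
              (E₀₀ / 64) * ((k₁.divisors.card : ℝ) * (15 * (∑ p ∈ k₁.primeFactors, Real.log p ^ 2) ^ 3 -
                30 * ((∑ p ∈ k₁.primeFactors, Real.log p ^ 2) * ∑ p ∈ k₁.primeFactors, Real.log p ^ 4) +
                16 * ∑ p ∈ k₁.primeFactors, Real.log p ^ 6) *
                (k₂.divisors.card : ℝ) * (2 * (lam * Real.log M) - 2 * Real.log g - Real.log k₁ - Real.log k₂) ^ 0) +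
              (1 / 128) * ((k₁.divisors.card : ℝ) * ((k₂.divisors.card : ℝ) *
                (15 * (∑ p ∈ k₂.primeFactors, Real.log p ^ 2) ^ 3 -
                30 * ((∑ p ∈ k₂.primeFactors, Real.log p ^ 2) * ∑ p ∈ k₂.primeFactors, Real.log p ^ 4) +
                16 * ∑ p ∈ k₂.primeFactors, Real.log p ^ 6)) *
                (2 * (lam * Real.log M) - 2 * Real.log g - Real.log k₁ - Real.log k₂) ^ 1) +
              (E₀₀ / 64) * ((k₁.divisors.card : ℝ) * ((k₂.divisors.card : ℝ) *
                (15 * (∑ p ∈ k₂.primeFactors, Real.log p ^ 2) ^ 3 -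
                30 * ((∑ p ∈ k₂.primeFactors, Real.log p ^ 2) * ∑ p ∈ k₂.primeFactors, Real.log p ^ 4) +
                16 * ∑ p ∈ k₂.primeFactors, Real.log p ^ 6)) *
                (2 * (lam * Real.log M) - 2 * Real.log g - Real.log k₁ - Real.log k₂) ^ 0) +
              (15 / 128) * ((k₁.divisors.card : ℝ) * (3 * (∑ p ∈ k₁.primeFactors, Real.log p ^ 2) ^ 2 - 2 * ∑ p ∈ k₁.primeFactors, Real.log p ^ 4) *
                ((k₂.divisors.card : ℝ) * (∑ p ∈ k₂.primeFactors, Real.log p ^ 2)) *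
                (2 * (lam * Real.log M) - 2 * Real.log g - Real.log k₁ - Real.log k₂) ^ 1) +
              (15 * E₀₀ / 64) * ((k₁.divisors.card : ℝ) * (3 * (∑ p ∈ k₁.primeFactors, Real.log p ^ 2) ^ 2 - 2 * ∑ p ∈ k₁.primeFactors, Real.log p ^ 4) *
                ((k₂.divisors.card : ℝ) * (∑ p ∈ k₂.primeFactors, Real.log p ^ 2)) *
                (2 * (lam * Real.log M) - 2 * Real.log g - Real.log k₁ - Real.log k₂) ^ 0) +
              (15 / 128) * ((k₁.divisors.card : ℝ) * (∑ p ∈ k₁.primeFactors, Real.log p ^ 2) *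
                ((k₂.divisors.card : ℝ) * (3 * (∑ p ∈ k₂.primeFactors, Real.log p ^ 2) ^ 2 - 2 * ∑ p ∈ k₂.primeFactors, Real.log p ^ 4)) *
                (2 * (lam * Real.log M) - 2 * Real.log g - Real.log k₁ - Real.log k₂) ^ 1) +
              (15 * E₀₀ / 64) * ((k₁.divisors.card : ℝ) * (∑ p ∈ k₁.primeFactors, Real.log p ^ 2) *
                ((k₂.divisors.card : ℝ) * (3 * (∑ p ∈ k₂.primeFactors, Real.log p ^ 2) ^ 2 - 2 * ∑ p ∈ k₂.primeFactors, Real.log p ^ 4)) *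
                (2 * (lam * Real.log M) - 2 * Real.log g - Real.log k₁ - Real.log k₂) ^ 0)) -
        (fun (lam : ℝ) (P : ℝ[X]) ↦ (π ^ 2 / 6) ^ 2 * ((1 / 896) * (∑ j ∈ Finset.range (7 + 1), ∑ i ∈ Finset.range (j + 1),
            ((7 : ℕ).choose j : ℝ) * (j.choose i : ℝ) * 2 ^ (7 - j) *
              ∫ u in (0 : ℝ)..1, (((Polynomial.C lam - X) ^ (7 - j) * derivative (derivative (X ^ i * P))) *
                derivative (derivative (X ^ (j - i) * P))).eval u) +
          (-1 / 320) * (∑ j ∈ Finset.range (5 + 1), ∑ i ∈ Finset.range (j + 1),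
            ((5 : ℕ).choose j : ℝ) * (j.choose i : ℝ) * 2 ^ (5 - j) *
              ∫ u in (0 : ℝ)..1, (((Polynomial.C lam - X) ^ (5 - j) * (-(2 : ℝ) • (X ^ i * P))) *
                derivative (derivative (X ^ (j - i) * P))).eval u) +
          (-1 / 64) * (∑ j ∈ Finset.range (3 + 1), ∑ i ∈ Finset.range (j + 1),
            ((3 : ℕ).choose j : ℝ) * (j.choose i : ℝ) * 2 ^ (3 - j) *
              ∫ u in (0 : ℝ)..1, (((Polynomial.C lam - X) ^ (3 - j) * (-(2 : ℝ) • (X ^ i * P))) *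
                (-(2 : ℝ) • (X ^ (j - i) * P))).eval u))) lam P * Real.log M ^ 4| ≤ C * Real.log M ^ 3 := by
  intro P hP0 hP1 lam hlam0 hlam1 E₀₀ E₀₁ E₀₂ E₀₃ E₀₄ E₁₀ E₁₁ E₁₂ E₁₃ E₁₄ E₂₀ E₂₁ E₂₂ E₂₃ E₂₄ μ₂ μ₄ μ₆
  exact abs_selbergOrderTwoFourPoly_sub_le_of_M4P2 P hP0 hP1 hlam0 hlam1 E₀₀ E₀₁ E₀₂ E₀₃ E₀₄ E₁₀ E₁₁ E₁₂ E₁₃ E₁₄ E₂₀ E₂₁ E₂₂ E₂₃ E₂₄ μ₂ μ₄ μ₆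
    (fun m hm ↦ (hM4P2 P hP0 hP1 lam hlam0 hlam1 m hm).1) (fun m hm ↦ (hM4P2 P hP0 hP1 lam hlam0 hlam1 m hm).2)

end Summit.Parity.GeneralizedHardyLittlewood.Theorems.MomentsBeyondDiagonal.DiagKernel

end
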